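import Mathlib.MeasureTheory.Function.Jacobian
import Mathlib.MeasureTheory.Constructions.Pi
import Mathlib.MeasureTheory.Measure.Lebesgue.EqHaar
import Mathlib.Analysis.SpecialFunctions.Pow.Real
import Mathlib.Analysis.SpecialFunctions.Log.Basic
import Mathlib.Analysis.Calculus.ContDiff.Operations
import Mathlib.LinearAlgebra.Matrix.Nondegenerate
import Mathlib.LinearAlgebra.Matrix.Adjugate
import HarnessLib

/-!
# Monomial charts of the open unit cube and their stellar refinements

For an exponent matrix `A ∈ ℕ^{n×n}` the **monomial map** `μ_A v = (∏ⱼ vⱼ ^ A i j)ᵢ` is the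
multiplicative form of the linear map `L ↦ A L` in logarithmic coordinates `L = -log v`: it sends
the open unit cube `(0,1)ⁿ` (`= ` the open orthant `L > 0`) onto `exp` of minus the open simplicial
cone spanned by the columns of `A`.  This file is the elementary toolkit behind "simplicial toric
charts" of the cube used in real-analytic monomialization arguments (Jung/Bierstone–Milman style
rectilinearization, Goward's principalization of monomial ideals):

* `openCube`, `posOrthant`, `monoMap` and the calculus `μ_{AB} = μ_A ∘ μ_B`, `μ_1 = id`,
  positivity, preservation of the cube and injectivity on the orthant when `det A ≠ 0`,
  smoothness, and "Lebesgue-null sets go to null sets";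
* `IsGoodFamily L`: a finite list of exponent matrices with nonsingular real determinants, pairwise
  disjoint cube images and conull union of images, and its stability under refinement of every
  member by a good family (`IsGoodFamily.flatMap`).

Sources: folklore toric geometry (W. Fulton, *Introduction to toric varieties*, 1993, §2.6;
R. Goward, *A simple algorithm for principalization of monomial ideals*, 2005, §2).  Design
choice: only `det A ≠ 0` (simplicial cones) is recorded, never unimodularity, since the charts are
used as real-analytic maps of the open cube.  Not here: fans and cones as subsets of `ℝⁿ`; the stellar
pair of charts (`CubeMonomialChartsStellar`) and the refinement algorithm making finitely many
monomials pairwise comparable (`CubeMonomialChartsPrincipalization`).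
-/

noncomputable section

open Set MeasureTheory

namespace Literature.AlgebraicGeometry.Resolution

namespace MonomialCubeChart

variable {n : ℕ}

/-- The open unit cube `(0,1)ⁿ ⊆ ℝⁿ`. [folklore] -/
def openCube (n : ℕ) : Set (Fin n → ℝ) := Set.pi Set.univ (fun _ : Fin n => Set.Ioo (0:ℝ) 1)

/-- The open positive orthant `(0,∞)ⁿ ⊆ ℝⁿ`. [folklore] -/
def posOrthant (n : ℕ) : Set (Fin n → ℝ) := {v | ∀ i, 0 < v i}

/-- The monomial map `μ_A v = (∏ⱼ vⱼ ^ A i j)ᵢ` of an exponent matrix `A ∈ ℕ^{n×n}`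
(Fulton 1993, §2.6, in multiplicative coordinates). [folklore] -/
def monoMap (A : Matrix (Fin n) (Fin n) ℕ) : (Fin n → ℝ) → (Fin n → ℝ) :=
  fun v i => ∏ j, v j ^ A i j

/-- Membership in the open cube, coordinatewise. [folklore] -/
theorem mem_openCube {v : Fin n → ℝ} : v ∈ openCube n ↔ ∀ i, 0 < v i ∧ v i < 1 := by
  simp [openCube]

/-- The open cube lies in the open orthant. [folklore] -/
theorem openCube_subset_posOrthant : openCube n ⊆ posOrthant n :=
  fun _ hv i => ((mem_openCube.1 hv) i).1

/-- Components of the monomial map. [folklore] -/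
theorem monoMap_apply (A : Matrix (Fin n) (Fin n) ℕ) (v : Fin n → ℝ) (i : Fin n) :
    monoMap A v i = ∏ j, v j ^ A i j := rfl

/-- `μ_{AB} = μ_A ∘ μ_B` (valid on all of `ℝⁿ` for natural exponents). [folklore] -/
theorem monoMap_mul (A B : Matrix (Fin n) (Fin n) ℕ) :
    monoMap (A * B) = monoMap A ∘ monoMap B := by
  funext v
  funext i
  simp only [Function.comp_apply, monoMap, Matrix.mul_apply]
  calc ∏ j, v j ^ (∑ k, A i k * B k j) = ∏ j, ∏ k, (v j ^ B k j) ^ A i k := by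
        refine Finset.prod_congr rfl fun j _ => ?_
        rw [← Finset.prod_pow_eq_pow_sum]
        refine Finset.prod_congr rfl fun k _ => ?_
        rw [mul_comm, pow_mul]
    _ = ∏ k, (∏ j, v j ^ B k j) ^ A i k := by
        rw [Finset.prod_comm]
        refine Finset.prod_congr rfl fun k _ => ?_
        rw [Finset.prod_pow]

/-- Pointwise form of `monoMap_mul`. [folklore] -/
theorem monoMap_mul_apply (A B : Matrix (Fin n) (Fin n) ℕ) (v : Fin n → ℝ) :
    monoMap (A * B) v = monoMap A (monoMap B v) := by
  rw [monoMap_mul]; rfl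

/-- `μ_1 = id`. [folklore] -/
theorem monoMap_one : monoMap (1 : Matrix (Fin n) (Fin n) ℕ) = id := by
  funext v
  funext i
  simp only [monoMap, id]
  rw [Finset.prod_eq_single i (fun j _ hj => by rw [Matrix.one_apply_ne' hj, pow_zero])
    (fun h => absurd (Finset.mem_univ i) h), Matrix.one_apply_eq, pow_one]

/-- Monomial maps of positive vectors are positive. [folklore] -/
theorem monoMap_pos (A : Matrix (Fin n) (Fin n) ℕ) {v : Fin n → ℝ} (hv : ∀ i, 0 < v i)
    (i : Fin n) : 0 < monoMap A v i :=
  Finset.prod_pos fun j _ => pow_pos (hv j) _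

/-- Monomial maps preserve the open orthant. [folklore] -/
theorem monoMap_mem_posOrthant (A : Matrix (Fin n) (Fin n) ℕ) {v : Fin n → ℝ}
    (hv : v ∈ posOrthant n) : monoMap A v ∈ posOrthant n :=
  fun i => monoMap_pos A hv i

/-- A matrix with nonzero (real) determinant has no zero row. [folklore] -/
theorem exists_ne_zero_of_det_ne_zero {A : Matrix (Fin n) (Fin n) ℕ}
    (hA : (A.map (fun t : ℕ => (t : ℝ))).det ≠ 0) (i : Fin n) : ∃ j, A i j ≠ 0 := by
  by_contra h
  push Not at h
  exact hA (Matrix.det_eq_zero_of_row_eq_zero i fun j => by simp [h j])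

/-- A monomial map with nonsingular exponent matrix maps the open cube into itself. [folklore] -/
theorem monoMap_mapsTo {A : Matrix (Fin n) (Fin n) ℕ}
    (hA : (A.map (fun t : ℕ => (t : ℝ))).det ≠ 0) :
    MapsTo (monoMap A) (openCube n) (openCube n) := by
  intro v hv
  rw [mem_openCube] at hv ⊢
  intro i
  refine ⟨monoMap_pos A (fun k => (hv k).1) i, ?_⟩
  obtain ⟨j, hj⟩ := exists_ne_zero_of_det_ne_zero hA i
  rw [monoMap_apply, ← Finset.mul_prod_erase Finset.univ _ (Finset.mem_univ j)]
  calc v j ^ A i j * ∏ k ∈ Finset.univ.erase j, v k ^ A i k ≤ v j ^ A i j * 1 := by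
        refine mul_le_mul_of_nonneg_left ?_ (pow_nonneg (hv j).1.le _)
        exact Finset.prod_le_one (fun k _ => pow_nonneg (hv k).1.le _)
          (fun k _ => pow_le_one₀ (hv k).1.le (hv k).2.le)
    _ < 1 := by rw [mul_one]; exact pow_lt_one₀ (hv j).1.le (hv j).2 hj

/-- Logarithm of a monomial map: `log (μ_A v)ᵢ = Σⱼ A i j log vⱼ`. [folklore] -/
theorem log_monoMap (A : Matrix (Fin n) (Fin n) ℕ) {v : Fin n → ℝ} (hv : ∀ i, 0 < v i)
    (i : Fin n) :
    Real.log (monoMap A v i) =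
      (A.map (fun t : ℕ => (t : ℝ))).mulVec (fun j => Real.log (v j)) i := by
  rw [monoMap_apply, Real.log_prod (fun j _ => pow_ne_zero _ (hv j).ne')]
  simp [Matrix.mulVec, dotProduct, Real.log_pow]

/-- A monomial map with nonsingular exponent matrix is injective on the open orthant. [folklore] -/
theorem monoMap_injOn {A : Matrix (Fin n) (Fin n) ℕ}
    (hA : (A.map (fun t : ℕ => (t : ℝ))).det ≠ 0) : InjOn (monoMap A) (posOrthant n) := by
  intro v hv w hw h
  have hsub : (A.map (fun t : ℕ => (t : ℝ))).mulVec
      ((fun j => Real.log (v j)) - fun j => Real.log (w j)) = 0 := by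
    rw [Matrix.mulVec_sub]
    funext i
    rw [Pi.sub_apply, ← log_monoMap A hv, ← log_monoMap A hw, h, sub_self, Pi.zero_apply]
  have h0 := Matrix.eq_zero_of_mulVec_eq_zero hA hsub
  funext j
  have hj := congrFun h0 j
  simp only [Pi.sub_apply, Pi.zero_apply, sub_eq_zero] at hj
  exact Real.log_injOn_pos (Set.mem_Ioi.2 (hv j)) (Set.mem_Ioi.2 (hw j)) hj

/-- Monomial maps are `C¹` (indeed polynomial). [folklore] -/
theorem contDiff_monoMap (A : Matrix (Fin n) (Fin n) ℕ) : ContDiff ℝ 1 (monoMap A) :=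
  contDiff_pi' fun i => contDiff_prod fun j _ => (contDiff_apply ℝ ℝ j).pow (A i j)

/-- Monomial maps are differentiable. [folklore] -/
theorem differentiable_monoMap (A : Matrix (Fin n) (Fin n) ℕ) : Differentiable ℝ (monoMap A) :=
  (contDiff_monoMap A).differentiable one_ne_zero

/-- Monomial maps send Lebesgue-null sets to Lebesgue-null sets. [folklore] -/
theorem volume_image_monoMap_null (A : Matrix (Fin n) (Fin n) ℕ) {s : Set (Fin n → ℝ)}
    (hs : volume s = 0) : volume (monoMap A '' s) = 0 :=
  addHaar_image_eq_zero_of_differentiableOn_of_addHaar_eq_zero volume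
    (differentiable_monoMap A).differentiableOn hs

/-- Entrywise cast commutes with products of exponent matrices. [folklore] -/
theorem map_natCast_mul (A E : Matrix (Fin n) (Fin n) ℕ) :
    (A * E).map (fun t : ℕ => (t : ℝ)) =
      A.map (fun t : ℕ => (t : ℝ)) * E.map (fun t : ℕ => (t : ℝ)) := by
  ext i j
  simp [Matrix.mul_apply]

/-! ## Good families of cube charts -/

/-- A **good family of cube charts**: a finite list of exponent matrices `A ∈ ℕ^{n×n}` with
`det A ≠ 0`, whose monomial maps have pairwise disjoint images of the open cube whose union is
conull in the open cube (a "simplicial fan supported on the positive orthant", multiplicatively).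
[folklore] -/
structure IsGoodFamily (L : List (Matrix (Fin n) (Fin n) ℕ)) : Prop where
  /-- every exponent matrix is nonsingular -/
  det_ne_zero : ∀ A ∈ L, (A.map (fun t : ℕ => (t : ℝ))).det ≠ 0
  /-- the cube images are pairwise disjoint -/
  pairwise_disjoint :
    L.Pairwise (fun A B => Disjoint (monoMap A '' openCube n) (monoMap B '' openCube n))
  /-- the cube images cover the cube up to a null set -/
  volume_diff : volume (openCube n \ ⋃ A ∈ L, monoMap A '' openCube n) = 0

/-- The identity chart alone is a good family. [folklore] -/
theorem isGoodFamily_one : IsGoodFamily [(1 : Matrix (Fin n) (Fin n) ℕ)] where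
  det_ne_zero := by
    intro A hA
    rw [List.mem_singleton] at hA
    subst hA
    rw [Matrix.map_one _ Nat.cast_zero Nat.cast_one, Matrix.det_one]
    exact one_ne_zero
  pairwise_disjoint := List.pairwise_singleton _ _
  volume_diff := by
    refine measure_mono_null (fun w hw => ?_) (measure_empty (μ := volume))
    refine (hw.2 (Set.mem_iUnion₂.2 ⟨1, List.mem_singleton.2 rfl, ?_⟩)).elim
    rw [monoMap_one, Set.image_id]
    exact hw.1

/-- Finite unions over a list of null sets are null. [folklore] -/
theorem measure_biUnion_list_null {α β : Type*} [MeasurableSpace α] {μ : Measure α} (L : List β)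
    {f : β → Set α} (h : ∀ b ∈ L, μ (f b) = 0) : μ (⋃ b ∈ L, f b) = 0 := by
  induction L with
  | nil => simp
  | cons b L ih =>
    simp only [List.mem_cons, Set.iUnion_iUnion_eq_or_left]
    exact measure_union_null (h b List.mem_cons_self)
      (ih fun x hx => h x (List.mem_cons_of_mem _ hx))

/-- **Refinement.** Replacing every member `A` of a good family by the charts `A * E`, `E`
running through a good family `F A`, gives a good family: images compose
(`μ_{AE} = μ_A ∘ μ_E`), `μ_A` is injective on the orthant and maps null sets to null sets.
[folklore] -/
theorem IsGoodFamily.flatMap {L : List (Matrix (Fin n) (Fin n) ℕ)} (hL : IsGoodFamily L)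
    (G F : Matrix (Fin n) (Fin n) ℕ → List (Matrix (Fin n) (Fin n) ℕ))
    (hF : ∀ A ∈ L, IsGoodFamily (F A)) (hG : ∀ A ∈ L, G A = (F A).map (A * ·)) :
    IsGoodFamily (L.flatMap G) := by
  refine ⟨?_, ?_, ?_⟩
  · intro C hC
    rw [List.mem_flatMap] at hC
    obtain ⟨A, hA, hC⟩ := hC
    rw [hG A hA, List.mem_map] at hC
    obtain ⟨E, hE, rfl⟩ := hC
    rw [map_natCast_mul, Matrix.det_mul]
    exact mul_ne_zero (hL.det_ne_zero A hA) ((hF A hA).det_ne_zero E hE)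
  · rw [List.pairwise_flatMap]
    refine ⟨fun A hA => ?_, ?_⟩
    · rw [hG A hA, List.pairwise_map]
      refine (hF A hA).pairwise_disjoint.imp fun {E E'} h => ?_
      rw [monoMap_mul, monoMap_mul, Set.image_comp, Set.image_comp]
      exact h.image (monoMap_injOn (hL.det_ne_zero A hA))
        (Set.image_subset_iff.2 fun v hv =>
          monoMap_mem_posOrthant E (openCube_subset_posOrthant hv))
        (Set.image_subset_iff.2 fun v hv =>
          monoMap_mem_posOrthant E' (openCube_subset_posOrthant hv))
    · refine hL.pairwise_disjoint.imp_of_mem ?_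
      intro A B hA hB h C hC D hD
      rw [hG A hA, List.mem_map] at hC
      rw [hG B hB, List.mem_map] at hD
      obtain ⟨E, hE, rfl⟩ := hC
      obtain ⟨E', hE', rfl⟩ := hD
      refine h.mono ?_ ?_
      · rw [monoMap_mul, Set.image_comp]
        exact Set.image_mono (monoMap_mapsTo ((hF A hA).det_ne_zero E hE)).image_subset
      · rw [monoMap_mul, Set.image_comp]
        exact Set.image_mono (monoMap_mapsTo ((hF B hB).det_ne_zero E' hE')).image_subset
  · have hsub : openCube n \ (⋃ C ∈ L.flatMap G, monoMap C '' openCube n) ⊆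
        (openCube n \ ⋃ A ∈ L, monoMap A '' openCube n) ∪
          ⋃ A ∈ L, monoMap A '' (openCube n \ ⋃ E ∈ F A, monoMap E '' openCube n) := by
      rintro w ⟨hw, hnot⟩
      by_cases h : w ∈ ⋃ A ∈ L, monoMap A '' openCube n
      · right
        rw [Set.mem_iUnion₂] at h
        obtain ⟨A, hA, v, hv, rfl⟩ := h
        refine Set.mem_iUnion₂.2 ⟨A, hA, v, ⟨hv, fun hv' => hnot ?_⟩, rfl⟩
        rw [Set.mem_iUnion₂] at hv'
        obtain ⟨E, hE, u, hu, rfl⟩ := hv'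
        refine Set.mem_iUnion₂.2 ⟨A * E, List.mem_flatMap.2 ⟨A, hA, ?_⟩, u, hu, ?_⟩
        · rw [hG A hA]
          exact List.mem_map.2 ⟨E, hE, rfl⟩
        · rw [monoMap_mul_apply]
      · exact Or.inl ⟨hw, h⟩
    refine measure_mono_null hsub (measure_union_null hL.volume_diff ?_)
    exact measure_biUnion_list_null L fun A hA =>
      volume_image_monoMap_null A (hF A hA).volume_diff

end MonomialCubeChart

end Literature.AlgebraicGeometry.Resolution

end
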